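import Literature.Dynamics.SymbolicDynamics.Hochman2025NewWitnesses
import Literature.Dynamics.SymbolicDynamics.Hochman2025CoinValues
import HarnessLib

/-!
# Hochman 2025, Theorem 1.1: the glued configuration, strong irreducibility, and the theorem

Final assembly of the proof of Theorem 1.1 of M. Hochman, *Irreducibility and periodicity in
`ℤ²` symbolic systems* (Discrete Analysis 2025:17), §6: for `x, y ∈ X₀` with dense valid
compatible certificates `Cx, Cy` and a finite non-empty `20`-chain-connected `J`, the glued
certificate `Cfin` of `Hochman2025NewWitnesses.lean` is dense and valid; here we define the glued
configuration `z` ("`z = x|_{E_x} ∪ y|_{E_y}`" extended at the free sites by the symbols of the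
witnesses, §6.2 (1)–(2)) and prove

* `Cfin_compat` — `z` is compatible with `Cfin` (kept frames: the sequential relocation of
  `Hochman2025CoinValues.lean` started from `CBC(x, F)`, resp. `CBC(y, F)`; new frames: the
  big-bucket symbols); `z = y` on `J` and `z = x` on the outer far region (`z_eq_y`, `z_eq_x`):
  a witness whose symbol is prescribed differently never sits at such a site, because moved and
  new witnesses are gap points (free sites) and unmoved ones lie in their own zone;
* `admitsGluing_outer` — hence `X₀` admits gluing along `(Outer 20 J, J)`, and by the reduction
  of `Hochman2025Outer.lean` **`X₀` is strongly irreducible with gap `20` along finite sets**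
  (`isFinitelyStronglyIrreducible_X0`; Hochman states gap `10` for his slightly different zones);
* `Hochman2025_existsSIAperiodic_holds` — **Theorem 1.1**: with the standard parameters, recode
  the alphabet `{H,T}^{Θ×Σ}` as `Fin k` and apply `Hochman2025_existsSIAperiodic.of_core`
  (non-emptiness, shift invariance and uniform local aperiodicity of `X₀` are in
  `Hochman2025Certificates.lean`; the closure of `X₀` is then the subshift of the theorem, sliced
  up to all `d ≥ 2`).

The uniqueness of the witness of `Cfin` at a given (site, class) slot (`slot_unique`, Cor. 5.3
for the valid `Cfin`: "by Corollary 5.3 we never will attempt to define any component of a symbol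
more than once", §6.2) makes `z` well defined.

## References

* [Hochman2025] M. Hochman, op. cit., Thm 1.1, §6.2 (definition of `z`), §6.3 (symbols at the
  witnesses), Cor 5.3. Read via `lit read arxiv:2401.02273`.
-/

noncomputable section

open Set Metric Complex Finset

namespace Literature.Dynamics.SymbolicDynamics

namespace Hochman2025

open _root_.SymbolicDynamics.FullShift

variable {P : Params}

/-! ### Sites of points of different boxes of a frame differ -/

/-- Points of two different boxes of a well-formed frame of level `≥ 1` are `≥ 100 h ≥ 800`
apart, hence have different sites. [cite: Hochman2025, Cor 5.3 (same frame)] -/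
theorem Frame.site_ne_of_mem_box (hP : P.Good) {n : ℕ} (hn : 1 ≤ n) {F : Frame P n} (hF : F.WF)
    {j j' : Fin (P.N n)} (hjj' : j ≠ j') {p q : ℂ} (hp : p ∈ F.box j) (hq : q ∈ F.box j') :
    Plane.site p ≠ Plane.site q := by
  intro hs
  have hlt := Std.norm_sub_lt_two_of_site_eq hs
  obtain ⟨-, -, h3, h4⟩ := hp
  obtain ⟨-, -, h3', h4'⟩ := hq
  have hapart := hF.apart j j' hjj'
  obtain ⟨-, hy⟩ := Plane.abs_coords_sub_le F.v F.c p q F.norm_v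
  change |(F.φ p).2 - (F.φ q).2| ≤ ‖p - q‖ at hy
  change F.t j ≤ (F.φ p).2 at h3
  change (F.φ p).2 ≤ F.t j + P.h n at h4
  change F.t j' ≤ (F.φ q).2 at h3'
  change (F.φ q).2 ≤ F.t j' + P.h n at h4'
  have hh := Params.h_one_le hP hn
  have h8 := hP.h_one
  rw [abs_le] at hy
  rw [le_abs] at hapart
  rcases hapart with h | h <;> linarith

namespace Gluing

namespace Setup

variable (D : Setup P)

/-- Frames of the glued certificate have level `≥ 1`. [folklore] -/
theorem one_le_of_mem_Cfin {m : ℕ} {F : Frame P m} (hF : F ∈ D.Cfin.frames m) : 1 ≤ m := by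
  rcases mem_Cfin.mp hF with hF | ⟨hm, -, -, -⟩
  · rcases mem_Ckept.mp hF with ⟨hm, -⟩ | ⟨hm, -⟩ <;> exact hm
  · exact hm

/-! ### Kinds of frames of the glued certificate -/

/-- `F` is a kept `x`-frame. [folklore] -/
def IsKX {m : ℕ} (F : Frame P (m + 1)) : Prop :=
  ∃ G : {G : Frame P (m + 1) // G ∈ D.Cx.frames (m + 1)},
    KeepX D.J (m + 1) G.1 ∧ F = relocFrame D.hP D.J D.hVx (Nat.le_add_left 1 m) G.1 G.2

/-- `F` is a kept `y`-frame. [folklore] -/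
def IsKY {m : ℕ} (F : Frame P (m + 1)) : Prop :=
  ∃ G : {G : Frame P (m + 1) // G ∈ D.Cy.frames (m + 1)},
    KeepY D.J (m + 1) G.1 ∧ F = relocFrame D.hP D.J D.hVy (Nat.le_add_left 1 m) G.1 G.2

/-- `F` is a new frame. [folklore] -/
def IsNew {m : ℕ} (F : Frame P (m + 1)) : Prop :=
  ∃ (u : ℂ) (hu : u ∈ D.NewCentres (m + 1)), F = newFrame (Nat.le_add_left 1 m) u hu

/-- The three kinds exhaust the glued certificate. [folklore] -/
theorem kinds_of_mem_Cfin {m : ℕ} {F : Frame P (m + 1)} (hF : F ∈ D.Cfin.frames (m + 1)) :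
    D.IsKX F ∨ D.IsKY F ∨ D.IsNew F := by
  rcases mem_Cfin.mp hF with hF | ⟨hm, u, hu, rfl⟩
  · rcases mem_Ckept.mp hF with ⟨hm, G, hG, hK, rfl⟩ | ⟨hm, G, hG, hK, rfl⟩
    · exact Or.inl ⟨⟨G, hG⟩, hK, rfl⟩
    · exact Or.inr (Or.inl ⟨⟨G, hG⟩, hK, rfl⟩)
  · exact Or.inr (Or.inr ⟨u, hu, rfl⟩)

/-- Kept `x`- and `y`-frames differ (their centres are far apart). [folklore] -/
theorem not_isKX_of_isKY {m : ℕ} {F : Frame P (m + 1)} (hy : D.IsKY F) : ¬ D.IsKX F := by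
  rintro ⟨Gx, hKx, hFx⟩
  obtain ⟨Gy, hKy, hFy⟩ := hy
  have hc : Gx.1.c = Gy.1.c := by
    have h1 : F.c = Gx.1.c := by rw [hFx]; rfl
    have h2 : F.c = Gy.1.c := by rw [hFy]; rfl
    rw [← h1, ← h2]
  have := norm_sub_gt_of_keepX_keepY hKx hKy
  rw [hc, sub_self, norm_zero] at this
  linarith [P.r_pos (m + 1)]

/-- New frames are not kept frames (new centres are far from kept centres). [folklore] -/
theorem not_isKX_of_isNew {m : ℕ} {F : Frame P (m + 1)} (hn : D.IsNew F) : ¬ D.IsKX F := by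
  rintro ⟨G, hK, hFx⟩
  obtain ⟨u, hu, hFn⟩ := hn
  have hmem : relocFrame D.hP D.J D.hVx (Nat.le_add_left 1 m) G.1 G.2 ∈ D.Ck.frames (m + 1) :=
    relocFrame_mem_Ckept_x (hVy := D.hVy) _ G.2 hK
  have := (D.newCentres_subset (m + 1) hu).2 G.1.c ⟨_, hmem, rfl⟩
  have hc : u = G.1.c := by
    have h1 : F.c = u := by rw [hFn]; rfl
    have h2 : F.c = G.1.c := by rw [hFx]; rfl
    rw [← h1, ← h2]
  rw [hc, sub_self, norm_zero] at this
  linarith [P.r_pos (m + 1)]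

/-- New frames are not kept `y`-frames. [folklore] -/
theorem not_isKY_of_isNew {m : ℕ} {F : Frame P (m + 1)} (hn : D.IsNew F) : ¬ D.IsKY F := by
  rintro ⟨G, hK, hFy⟩
  obtain ⟨u, hu, hFn⟩ := hn
  have hmem : relocFrame D.hP D.J D.hVy (Nat.le_add_left 1 m) G.1 G.2 ∈ D.Ck.frames (m + 1) :=
    relocFrame_mem_Ckept_y (hVx := D.hVx) _ G.2 hK
  have := (D.newCentres_subset (m + 1) hu).2 G.1.c ⟨_, hmem, rfl⟩
  have hc : u = G.1.c := by
    have h1 : F.c = u := by rw [hFn]; rfl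
    have h2 : F.c = G.1.c := by rw [hFy]; rfl
    rw [← h1, ← h2]
  rw [hc, sub_self, norm_zero] at this
  linarith [P.r_pos (m + 1)]

/-! ### The symbols prescribed at the witnesses of kept frames -/

section KeptVal

variable {C : Cert P} (hV : C.Valid D.hP) (b : ℤ × ℤ → Cls P → Bool) {m : ℕ}
  (G : {G : Frame P (m + 1) // G ∈ C.frames (m + 1)})

/-- The original coin of box `j`. [cite: Hochman2025, §5.6] -/
def korig (j : Fin (P.N (m + 1))) : (ℤ × ℤ) × Cls P := (Plane.site (G.1.w j) - G.1.z, (G.1.k, G.1.σ j))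

/-- The final coin of box `j` (relocated witness and its section). [cite: Hochman2025, §6.3 Step A] -/
def kfin (j : Fin (P.N (m + 1))) : (ℤ × ℤ) × Cls P :=
  (Plane.site ((relocFrame D.hP D.J hV (Nat.le_add_left 1 m) G.1 G.2).w j) - G.1.z,
    (G.1.k, (relocFrame D.hP D.J hV (Nat.le_add_left 1 m) G.1 G.2).σ j))

/-- Box `j` was moved. [cite: Hochman2025, §6.3 Step A (2)] -/
def Moved (j : Fin (P.N (m + 1))) : Prop := (Tset D.J G.1 (wpath D.hP hV (Nat.le_add_left 1 m) G.2 j)).Nonempty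

open Classical in
/-- **The symbol prescribed at the (relocated) witness of box `j` of a kept frame**: the result of
the sequential relocation started from `CBC(b, G)` (`b = x` or `y`). [cite: Hochman2025, §6.3 Step A] -/
def kval (j : Fin (P.N (m + 1))) : Bool :=
  seqConf (bucketsEquiv P (m + 1)) (fun s cl => b (s + G.1.z) cl) (korig G) (D.kfin hV G) (D.Moved hV G)
    (P.N (m + 1)) (D.kfin hV G j).1 (D.kfin hV G j).2

variable {D hV b G}

/-- Unmoved boxes keep their coin. [cite: Hochman2025, §6.3 Step A (1)] -/
theorem kfin_eq_korig {j : Fin (P.N (m + 1))} (hj : ¬ D.Moved hV G j) : D.kfin hV G j = korig G j := by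
  simp only [kfin, korig, relocFrame_w, relocFrame_σ, newW_of_empty hj (wpath_through _ _ _ _ _),
    newσ_of_empty _ _ _ hj]

/-- Original and final witnesses lie in their boxes. [folklore] -/
theorem korig_kfin_mem_box (j : Fin (P.N (m + 1))) :
    G.1.w j ∈ G.1.box j ∧ (relocFrame D.hP D.J hV (Nat.le_add_left 1 m) G.1 G.2).w j ∈ G.1.box j := by
  have hS : 0 < P.S := lt_of_lt_of_le (by norm_num) D.hP.S_le
  have hwf := hV.wf.frame _ G.1 G.2
  refine ⟨Frame.WF.w_mem_box G.1 hwf hS j, ?_⟩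
  have := newW_mem_sect D.hJ hV (Nat.le_add_left 1 m) G.2 j
  exact Plane.section_subset_box _ _ (P.r_pos _).le hS _ this

/-- The coins of different boxes are distinct, before and after relocation. [cite: Hochman2025, Cor 5.3] -/
theorem kcoins_distinct (j j' : Fin (P.N (m + 1))) (hjj' : j ≠ j') :
    korig G j ≠ korig G j' ∧ D.kfin hV G j ≠ D.kfin hV G j' ∧ korig G j ≠ D.kfin hV G j' := by
  have hwf := hV.wf.frame _ G.1 G.2
  have hb := korig_kfin_mem_box (D := D) (hV := hV) (G := G)
  refine ⟨?_, ?_, ?_⟩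
  · intro h
    have := congrArg (fun w => w.1) h
    simp only [korig, sub_left_inj] at this
    exact Frame.site_ne_of_mem_box D.hP (Nat.le_add_left 1 m) hwf hjj' (hb j).1 (hb j').1 this
  · intro h
    have := congrArg (fun w => w.1) h
    simp only [kfin, sub_left_inj] at this
    exact Frame.site_ne_of_mem_box D.hP (Nat.le_add_left 1 m) hwf hjj' (hb j).2 (hb j').2 this
  · intro h
    have := congrArg (fun w => w.1) h
    simp only [korig, kfin, sub_left_inj] at this
    exact Frame.site_ne_of_mem_box D.hP (Nat.le_add_left 1 m) hwf hjj' (hb j).1 (hb j').2 this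

/-- The coins of the relocated frame are the final coins. [folklore] -/
theorem coins_relocFrame : (relocFrame D.hP D.J hV (Nat.le_add_left 1 m) G.1 G.2).coins = Finset.univ.image (D.kfin hV G) := rfl

/-- The coins of the original frame are the original coins. [folklore] -/
theorem coins_orig : G.1.coins = Finset.univ.image (korig G) := rfl

open Classical in
/-- **The relocated frame is compatible with any configuration showing the prescribed symbols at
its witnesses**, if the original frame was compatible with `b`. [cite: Hochman2025, §6.3 Step A
("We again define `z` at the sites `w'` above so as to restore compatibility")] -/
theorem isUnorientable_of_kval (hcomp : CoinsAndBuckets.IsUnorientable (G.1.cbcF b))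
    (z : ℤ × ℤ → Cls P → Bool)
    (hz : ∀ j, z (Plane.site ((relocFrame D.hP D.J hV (Nat.le_add_left 1 m) G.1 G.2).w j))
      (G.1.k, (relocFrame D.hP D.J hV (Nat.le_add_left 1 m) G.1 G.2).σ j) = D.kval hV b G j) :
    CoinsAndBuckets.IsUnorientable ((relocFrame D.hP D.J hV (Nat.le_add_left 1 m) G.1 G.2).cbcF z) := by
  set e := bucketsEquiv P (m + 1)
  set conf := seqConf e (fun s cl => b (s + G.1.z) cl) (korig G) (D.kfin hV G) (D.Moved hV G) (P.N (m + 1))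
  have hdis := kcoins_distinct (D := D) (hV := hV) (G := G)
  have hmain := isUnorientable_seqConf e (fun s cl => b (s + G.1.z) cl) hdis
    (fun j hj => kfin_eq_korig hj) (by rw [← coins_orig]; exact hcomp) (P.N (m + 1))
  rw [coinSet_of_le le_rfl] at hmain
  have hcongr : (relocFrame D.hP D.J hV (Nat.le_add_left 1 m) G.1 G.2).cbcF z = cbc e conf (Finset.univ.image (D.kfin hV G)) := by
    unfold Frame.cbcF
    rw [coins_relocFrame]
    apply cbc_congr
    intro w hw
    obtain ⟨j, -, rfl⟩ := Finset.mem_image.mp hw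
    have h1 := hz j
    have hzz : (relocFrame D.hP D.J hV (Nat.le_add_left 1 m) G.1 G.2).z = G.1.z := rfl
    simp only [kfin]
    rw [hzz, sub_add_cancel, h1]
    rfl
  rw [hcongr]
  exact hmain

/-- **An unmoved witness keeps the symbol of `b`.** [cite: Hochman2025, §6.3 Step A (1)] -/
theorem kval_of_not_moved {j : Fin (P.N (m + 1))} (hj : ¬ D.Moved hV G j) :
    D.kval hV b G j = b (Plane.site (G.1.w j)) (G.1.k, G.1.σ j) := by
  classical
  unfold kval
  rw [kfin_eq_korig hj]
  rw [seqConf_apply_orig _ _ (kcoins_distinct (D := D) (hV := hV) (G := G)) hj]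
  simp [korig]

end KeptVal

/-! ### The glued configuration -/

section Z

variable (x y : ℤ × ℤ → Cls P → Bool)

open Classical in
/-- **The symbol prescribed at the witness of box `j` of a frame of the glued certificate.**
[cite: Hochman2025, §6.2 (2) and §6.3] -/
def fval : {m : ℕ} → Frame P m → Fin (P.N m) → Bool
  | 0, _, _ => false
  | _ + 1, F, j =>
    if hx : D.IsKX F then D.kval D.hVx x hx.choose j
    else if hy : D.IsKY F then D.kval D.hVy y hy.choose j
    else F.bval D.hP j

/-- A witness slot: a witness of the glued certificate at site `s` with class `cl`. [folklore] -/
def Slot (q : Σ m, Frame P m × Fin (P.N m)) (s : ℤ × ℤ) (cl : Cls P) : Prop :=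
  q.2.1 ∈ D.Cfin.frames q.1 ∧ Plane.site (q.2.1.w q.2.2) = s ∧ (q.2.1.k, q.2.1.σ q.2.2) = cl

open Classical in
/-- **The glued configuration `z`** (§6.2: "`z = x|_{E_x} ∪ y|_{E_y}`", extended at the free sites):
at a witness slot of the glued certificate the prescribed symbol, elsewhere `y` on `J` and `x`
off `J`. [cite: Hochman2025, §6.2 (1)–(2)] -/
def z (s : ℤ × ℤ) (cl : Cls P) : Bool :=
  if h : ∃ q : Σ m, Frame P m × Fin (P.N m), D.Slot q s cl then D.fval x y h.choose.2.1 h.choose.2.2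
  else if s ∈ D.J then y s cl else x s cl

variable {D x y}

/-- **Witness slots are unique** ("by Corollary 5.3 we never will attempt to define any component
of a symbol more than once"). [cite: Hochman2025, §6.2 and Cor 5.3] -/
theorem slot_unique {q q' : Σ m, Frame P m × Fin (P.N m)} {s : ℤ × ℤ} {cl : Cls P}
    (hq : D.Slot q s cl) (hq' : D.Slot q' s cl) : q = q' := by
  obtain ⟨m, F, j⟩ := q
  obtain ⟨m', F', j'⟩ := q'
  obtain ⟨hF, hs, hc⟩ := hq
  obtain ⟨hF', hs', hc'⟩ := hq'
  simp only at hF hs hc hF' hs' hc'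
  have hP := D.hP
  have hV := D.Cfin_valid
  have hm1 := D.one_le_of_mem_Cfin hF
  have hm1' := D.one_le_of_mem_Cfin hF'
  have hcc : (F.k, F.σ j) = (F'.k, F'.σ j') := by rw [hc, hc']
  have hk : F'.k = F.k := (congrArg Prod.fst hcc).symm
  have hσ : F.σ j = F'.σ j' := congrArg Prod.snd hcc
  have hsite : Plane.site (F.w j) = Plane.site (F'.w j') := by rw [hs, hs']
  have hlt := Std.norm_sub_lt_two_of_site_eq hsite
  have h8 := hP.h_one
  rcases lt_trichotomy m m' with hmm | rfl | hmm
  · have h1 := (Cert.cor_5_3_levels hP hV hm1 hmm hF hF' hk j j' hσ).1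
    have := Params.h_one_le hP hm1
    linarith
  · by_cases hFF : F = F'
    · subst hFF
      by_cases hjj : j = j'
      · subst hjj; rfl
      · have h1 := Cert.cor_5_3_same_frame hP hV.wf hF hjj
        have := Params.h_one_le hP hm1
        linarith
    · have h1 := Cert.cor_5_3_same_level hP hV.wf hF hF' hFF hk hσ
      have := r_ge hP hm1
      linarith
  · have h1 := (Cert.cor_5_3_levels hP hV hm1' hmm hF' hF hk.symm j' j hσ.symm).2
    have := Params.h_one_le hP hm1'
    linarith

/-- **`z` at a witness slot is the prescribed symbol.** [cite: Hochman2025, §6.2 (2)] -/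
theorem z_slot {m : ℕ} {F : Frame P m} (hF : F ∈ D.Cfin.frames m) (j : Fin (P.N m)) :
    D.z x y (Plane.site (F.w j)) (F.k, F.σ j) = D.fval x y F j := by
  classical
  have h : ∃ q : Σ m, Frame P m × Fin (P.N m), D.Slot q (Plane.site (F.w j)) (F.k, F.σ j) :=
    ⟨⟨m, F, j⟩, hF, rfl, rfl⟩
  unfold z
  rw [dif_pos h]
  have heq : h.choose = ⟨m, F, j⟩ := slot_unique h.choose_spec ⟨hF, rfl, rfl⟩
  have key : ∀ q q' : Σ m, Frame P m × Fin (P.N m), q = q' → D.fval x y q.2.1 q.2.2 = D.fval x y q'.2.1 q'.2.2 := by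
    rintro q _ rfl; rfl
  exact key _ _ heq

/-- The prescribed symbol of a kept `x`-frame. [folklore] -/
theorem fval_kx {m : ℕ} (G : {G : Frame P (m + 1) // G ∈ D.Cx.frames (m + 1)}) (hK : KeepX D.J (m + 1) G.1)
    (j : Fin (P.N (m + 1))) :
    D.fval x y (relocFrame D.hP D.J D.hVx (Nat.le_add_left 1 m) G.1 G.2) j = D.kval D.hVx x G j := by
  classical
  have hx : D.IsKX (relocFrame D.hP D.J D.hVx (Nat.le_add_left 1 m) G.1 G.2) := ⟨G, hK, rfl⟩
  simp only [fval, dif_pos hx]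
  congr 1
  obtain ⟨hK', heq⟩ := hx.choose_spec
  have hc : hx.choose.1.c = G.1.c := by
    have := congrArg Frame.c heq
    exact this.symm
  exact Subtype.ext (D.hVx.wf.c_injOn (m + 1) hx.choose.2 G.2 hc)

/-- The prescribed symbol of a kept `y`-frame. [folklore] -/
theorem fval_ky {m : ℕ} (G : {G : Frame P (m + 1) // G ∈ D.Cy.frames (m + 1)}) (hK : KeepY D.J (m + 1) G.1)
    (j : Fin (P.N (m + 1))) :
    D.fval x y (relocFrame D.hP D.J D.hVy (Nat.le_add_left 1 m) G.1 G.2) j = D.kval D.hVy y G j := by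
  classical
  have hy : D.IsKY (relocFrame D.hP D.J D.hVy (Nat.le_add_left 1 m) G.1 G.2) := ⟨G, hK, rfl⟩
  have hx : ¬ D.IsKX (relocFrame D.hP D.J D.hVy (Nat.le_add_left 1 m) G.1 G.2) := D.not_isKX_of_isKY hy
  simp only [fval, dif_neg hx, dif_pos hy]
  congr 1
  obtain ⟨hK', heq⟩ := hy.choose_spec
  have hc : hy.choose.1.c = G.1.c := by
    have := congrArg Frame.c heq
    exact this.symm
  exact Subtype.ext (D.hVy.wf.c_injOn (m + 1) hy.choose.2 G.2 hc)

/-- The prescribed symbol of a new frame. [folklore] -/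
theorem fval_new {m : ℕ} {u : ℂ} (hu : u ∈ D.NewCentres (m + 1)) (j : Fin (P.N (m + 1))) :
    D.fval x y (newFrame (Nat.le_add_left 1 m) u hu) j = (newFrame (Nat.le_add_left 1 m) u hu).bval D.hP j := by
  classical
  have hn : D.IsNew (newFrame (Nat.le_add_left 1 m) u hu) := ⟨u, hu, rfl⟩
  simp only [fval, dif_neg (D.not_isKX_of_isNew hn), dif_neg (D.not_isKY_of_isNew hn)]

/-! ### Compatibility -/

/-- The coins of a new frame are distinct. [cite: Hochman2025, Cor 5.3] -/
theorem coinOf_injective_newFrame {m : ℕ} {u : ℂ} (hu : u ∈ D.NewCentres (m + 1)) :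
    Function.Injective (newFrame (Nat.le_add_left 1 m) u hu).coinOf := by
  intro j j' h
  by_contra hjj'
  have hS : 0 < P.S := lt_of_lt_of_le (by norm_num) D.hP.S_le
  have hwf := newFrame_wf (Nat.le_add_left 1 m) hu
  have := congrArg (fun w => w.1) h
  simp only [Frame.coinOf, sub_left_inj] at this
  exact Frame.site_ne_of_mem_box D.hP (Nat.le_add_left 1 m) hwf hjj' (Frame.WF.w_mem_box _ hwf hS j) (Frame.WF.w_mem_box _ hwf hS j') this

/-- **The glued configuration is compatible with the glued certificate.**
[cite: Hochman2025, §6.2 (2) and §6.3] -/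
theorem Cfin_compat (hcx : D.Cx.Compat x) (hcy : D.Cy.Compat y) : D.Cfin.Compat (D.z x y) := by
  intro m F hF
  rcases D.kinds_of_mem_Cfin hF with ⟨G, hK, rfl⟩ | ⟨G, hK, rfl⟩ | ⟨u, hu, rfl⟩
  · refine isUnorientable_of_kval (hcx m G.1 G.2) (D.z x y) fun j => ?_
    exact (z_slot (x := x) (y := y) hF j).trans (fval_kx G hK j)
  · refine isUnorientable_of_kval (hcy m G.1 G.2) (D.z x y) fun j => ?_
    exact (z_slot (x := x) (y := y) hF j).trans (fval_ky G hK j)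
  · refine Frame.isUnorientable_of_bval _ D.hP (coinOf_injective_newFrame hu) (D.z x y) fun j => ?_
    rw [z_slot hF j]
    exact fval_new hu j

/-! ### Agreement with `y` on `J` and with `x` on the outer far region -/

/-- **`z = y` on `J`.** [cite: Hochman2025, §6.2 ("`z = x|_{E_x} ∪ y|_{E_y}`")] -/
theorem z_eq_y {s : ℤ × ℤ} (hs : s ∈ D.J) (cl : Cls P) : D.z x y s cl = y s cl := by
  classical
  have hJ := D.hJ
  by_cases h : ∃ q : Σ m, Frame P m × Fin (P.N m), D.Slot q s cl
  · obtain ⟨⟨m, F, j⟩, hF, hsite, hcl⟩ := h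
    simp only at hF hsite hcl
    rw [← hsite, ← hcl, z_slot hF j]
    have hm := D.one_le_of_mem_Cfin hF
    obtain ⟨m, rfl⟩ : ∃ m', m = m' + 1 := ⟨m - 1, by omega⟩
    rcases D.kinds_of_mem_Cfin hF with ⟨G, hK, rfl⟩ | ⟨G, hK, rfl⟩ | ⟨u, hu, rfl⟩
    · -- a kept `x`-witness never sits on `J`
      exfalso
      have hβ := β_newW_le_of_keepX D.hP hJ D.hVx (Nat.le_add_left 1 m) G.2 hK j
      have := site_not_mem_of_β_lt hJ (lt_of_le_of_lt hβ (by norm_num))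
      rw [← relocFrame_w (J := D.J) D.hVx (Nat.le_add_left 1 m) G.1 G.2 j] at this
      exact this (hsite ▸ hs)
    · -- a kept `y`-witness on `J` is unmoved and shows `y`
      rw [fval_ky G hK j]
      by_cases hmv : D.Moved D.hVy G j
      · exfalso
        have hgap := newW_mem_gap_of_nonempty hJ (wpath_continuous D.hP D.hVy (Nat.le_add_left 1 m) G.2 j) (w := G.1.w j) hmv
        have := (site_free_of_gap hJ hgap).1
        rw [← relocFrame_w (J := D.J) D.hVy (Nat.le_add_left 1 m) G.1 G.2 j] at this
        exact this (hsite ▸ hs)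
      · rw [kval_of_not_moved hmv]
        congr 1
        · rw [relocFrame_w, newW_of_empty hmv (wpath_through _ _ _ _ _)]
        · rw [relocFrame_σ, newσ_of_empty _ _ _ hmv]; rfl
    · exfalso
      have := (site_free_of_gap hJ (nwit_mem_gap (Nat.le_add_left 1 m) hu j)).1
      exact this (hsite ▸ hs)
  · unfold z
    rw [dif_neg h, if_pos hs]

/-- **`z = x` on the outer far region.** [cite: Hochman2025, §6.2 ("`z = x|_{E_x} ∪ y|_{E_y}`")] -/
theorem z_eq_x {s : ℤ × ℤ} (hs : s ∈ Outer 20 D.J) (cl : Cls P) : D.z x y s cl = x s cl := by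
  classical
  have hJ := D.hJ
  by_cases h : ∃ q : Σ m, Frame P m × Fin (P.N m), D.Slot q s cl
  · obtain ⟨⟨m, F, j⟩, hF, hsite, hcl⟩ := h
    simp only at hF hsite hcl
    rw [← hsite, ← hcl, z_slot hF j]
    have hm := D.one_le_of_mem_Cfin hF
    obtain ⟨m, rfl⟩ : ∃ m', m = m' + 1 := ⟨m - 1, by omega⟩
    rcases D.kinds_of_mem_Cfin hF with ⟨G, hK, rfl⟩ | ⟨G, hK, rfl⟩ | ⟨u, hu, rfl⟩
    · -- a kept `x`-witness on the outer region is unmoved and shows `x`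
      rw [fval_kx G hK j]
      by_cases hmv : D.Moved D.hVx G j
      · exfalso
        have hgap := newW_mem_gap_of_nonempty hJ (wpath_continuous D.hP D.hVx (Nat.le_add_left 1 m) G.2 j) (w := G.1.w j) hmv
        have := (site_free_of_gap hJ hgap).2
        rw [← relocFrame_w (J := D.J) D.hVx (Nat.le_add_left 1 m) G.1 G.2 j] at this
        exact this (hsite ▸ hs)
      · rw [kval_of_not_moved hmv]
        congr 1
        · rw [relocFrame_w, newW_of_empty hmv (wpath_through _ _ _ _ _)]
        · rw [relocFrame_σ, newσ_of_empty _ _ _ hmv]; rfl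
    · exfalso
      have hβ := le_β_newW_of_keepY D.hP hJ D.hVy (Nat.le_add_left 1 m) G.2 hK j
      have := site_not_mem_outer_of_one_le_β (J := D.J) (le_trans (by norm_num) hβ)
      rw [← relocFrame_w (J := D.J) D.hVy (Nat.le_add_left 1 m) G.1 G.2 j] at this
      exact this (hsite ▸ hs)
    · exfalso
      have := (site_free_of_gap hJ (nwit_mem_gap (Nat.le_add_left 1 m) hu j)).2
      exact this (hsite ▸ hs)
  · unfold z
    rw [dif_neg h, if_neg (fun hsJ => not_mem_outer_of_mem hsJ hs)]

end Z

end Setup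

end Gluing

/-! ### Strong irreducibility of `X₀` -/

/-- **`X₀` admits gluing of `y|_J` into `x` on the outer far region**, for every finite non-empty
`20`-chain-connected `J` — the conclusion of §6.3. [cite: Hochman2025, §6 (Thm 1.1, strong irreducibility)] -/
theorem admitsGluing_outer (hP : P.Good) (J : Finset (ℤ × ℤ)) (hJ : J.Nonempty)
    (hJc : ∀ p ∈ J, ∀ q ∈ J, Relation.ReflTransGen (ChainRel 20 (↑J : Set (ℤ × ℤ))) p q) :
    AdmitsGluing (X0 P hP) (Outer 20 J) (↑J : Set (ℤ × ℤ)) := by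
  rintro x ⟨Cx, hVx, hDx, hcx⟩ y ⟨Cy, hVy, hDy, hcy⟩
  set D : Gluing.Setup P := ⟨hP, J, hJ, hJc, Cx, Cy, hVx, hVy, hDx, hDy⟩
  refine ⟨D.z x y, ⟨D.Cfin, D.Cfin_valid, D.Cfin_dense, Gluing.Setup.Cfin_compat hcx hcy⟩,
    fun s hs => funext fun cl => Gluing.Setup.z_eq_x hs cl, fun s hs => funext fun cl => Gluing.Setup.z_eq_y hs cl⟩

/-- **`X₀` is strongly irreducible with gap `20` along finite sets** (Hochman: gap `10`).
[cite: Hochman2025, Thm 1.1 and §6] -/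
theorem isFinitelyStronglyIrreducible_X0 (hP : P.Good) : IsFinitelyStronglyIrreducible (X0 P hP) 20 := by
  have := isFinitelyStronglyIrreducible_of_outer (X := X0 P hP) (g := 20) (by norm_num)
    (fun J hJ hJc => by exact_mod_cast admitsGluing_outer hP J hJ hJc)
  exact_mod_cast this

/-! ### Recoding the alphabet and Theorem 1.1 -/

section Recode

variable {A B : Type*} (e : A ≃ B)

/-- Recoding configurations letter by letter. [folklore] -/
def recode (X : Set (ℤ × ℤ → A)) : Set (ℤ × ℤ → B) := (fun x => e ∘ x) '' X

/-- Recoding preserves non-emptiness. [folklore] -/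
theorem recode_nonempty {X : Set (ℤ × ℤ → A)} (h : X.Nonempty) : (recode e X).Nonempty := h.image _

/-- Recoding preserves shift invariance. [folklore] -/
theorem isShiftInvariant_recode {X : Set (ℤ × ℤ → A)} (h : IsShiftInvariant X) : IsShiftInvariant (recode e X) := by
  intro v x' hx'
  obtain ⟨x, hx, rfl⟩ := hx'
  exact ⟨shift v x, h v hx, rfl⟩

/-- Recoding preserves strong irreducibility along finite sets. [folklore] -/
theorem isFinitelyStronglyIrreducible_recode {X : Set (ℤ × ℤ → A)} {g : ℝ} (h : IsFinitelyStronglyIrreducible X g) :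
    IsFinitelyStronglyIrreducible (recode e X) g := by
  intro E F hEF x' hx' y' hy'
  obtain ⟨x, hx, rfl⟩ := hx'
  obtain ⟨y, hy, rfl⟩ := hy'
  obtain ⟨z, hz, hzx, hzy⟩ := h E F hEF x hx y hy
  refine ⟨e ∘ z, ⟨z, hz, rfl⟩, fun u hu => ?_, fun u hu => ?_⟩
  · simp only [Function.comp_apply, hzx hu]
  · simp only [Function.comp_apply, hzy hu]

/-- Recoding preserves uniform local aperiodicity. [folklore] -/
theorem isUniformlyLocallyAperiodic_recode {X : Set (ℤ × ℤ → A)} (h : IsUniformlyLocallyAperiodic X) :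
    IsUniformlyLocallyAperiodic (recode e X) := by
  intro n hn
  obtain ⟨R, hR⟩ := h n hn
  refine ⟨R, fun x' hx' c => ?_⟩
  obtain ⟨x, hx, rfl⟩ := hx'
  obtain ⟨u, v, h1, h2, h3, h4, h5, h6, h7⟩ := hR x hx c
  exact ⟨u, v, h1, h2, h3, h4, h5, h6, fun heq => h7 (e.injective heq)⟩

end Recode

end Hochman2025

open _root_.SymbolicDynamics.FullShift Hochman2025 in
/-- **Hochman 2025, Theorem 1.1**: for every `d ≥ 2` there exist strongly irreducible `ℤ^d`
subshifts without periodic points. Proof: with the standard parameters (`T = S = 1000`), the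
family `X₀` of configurations over `{H,T}^{Θ×Σ}` admitting a dense valid compatible certificate
(§5) is non-empty (Lemma 5.8), shift invariant (Lemma 5.6), uniformly locally aperiodic (Lemma 5.5
with dense levels) and strongly irreducible with gap `20` along finite sets (§6); recode its
alphabet as `Fin k` and apply `Hochman2025_existsSIAperiodic.of_core` (closure, `Fin 2 → ℤ`,
slices). [cite: Hochman2025, Thm 1.1] -/
theorem Hochman2025_existsSIAperiodic_holds : Hochman2025_existsSIAperiodic := by
  set P : Params := Params.std 1000 1000 with hPdef
  have hP : P.Good := Params.std_good le_rfl le_rfl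
  set e : (Cls P → Bool) ≃ Fin (Fintype.card (Cls P → Bool)) := Fintype.equivFin _
  exact Hochman2025_existsSIAperiodic.of_core ⟨_, recode e (X0 P hP), 20, by norm_num,
    recode_nonempty e (X0_nonempty hP), isShiftInvariant_recode e (isShiftInvariant_X0 hP),
    isFinitelyStronglyIrreducible_recode e (isFinitelyStronglyIrreducible_X0 hP),
    isUniformlyLocallyAperiodic_recode e (isUniformlyLocallyAperiodic_X0 hP)⟩

end Literature.Dynamics.SymbolicDynamics
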